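import Literature.MathematicalPhysics.QuantumLattice.DysonTwoTimeExpansion
import HarnessLib

/-!
# The two-time Dyson series of a perturbed Gibbs weight: coefficients as free expectations of TIME-ORDERED WORDS

Topic `MathematicalPhysics/QuantumLattice`; continuation of `DysonTwoTimeExpansion.lean`
(`Matrix.hasSum_dyson_trace_gibbs_twoTime`: `Tr(e^{-(β-s)(H₀+gV)} X e^{-s(H₀+gV)} Y) = Σ_N g^N Σ_{k+j=N} Tr(E_k(1-s/β) X E_j(s/β) Y)`,
coefficients as double ordered integrals) in the form used by the determinant (Wick) expansion of Benfatto–Giuliani–Mastropietro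
2006 §2.1 (2.8) for Schwinger functions at UNEQUAL imaginary times: for a perturbation `V = Σ_r v_r W_r` the integrand of the
`(k, j)` coefficient is

  `(-β)^{k+j} Σ_{f, f'} (∏ v_{f i})(∏ v_{f' l}) · Tr( e^{-βH₀} · Y · ∏_i W_{f i}(-βu_i) · X(-(β-s)) · ∏_l W_{f' l}(-(β-s) - βu'_l) )`

(`O(τ) = e^{τH₀} O e^{-τH₀}`): the un-normalised FREE expectation of the word «`Y` at time `0`, the `k` vertices of the first block at the
decreasing times `-βu_i ∈ [-(β-s), 0]`, the observable `X` at time `-(β-s)`, the `j` vertices of the second block at the decreasing times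
`-(β-s) - βu'_l ∈ [-β, -(β-s)]`» — the two-time analogue of `trace_dysonIntegrand_gibbs` / `hasSum_dyson_trace_gibbsWeight_sum`
(`DysonOrderedIntegral`), to which the time-ordered Wick theorem applies letter by letter.

* `Matrix.exp_mul_listProd_mul_exp_neg` — conjugation distributes over ordered products (any square matrices);
* **`Matrix.trace_dysonIntegrand_twoTime_gibbs`** — the integrand identity above;
* **`Matrix.hasSum_dyson_trace_gibbs_twoTime_sum`** — the two-time Dyson series with these coefficients, for `0 < β`, `0 ≤ s ≤ β`,
  every `g ∈ ℂ` and every pair of observables `X, Y`.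

Everything is PROVED; no definition is introduced.

## References

* G. Benfatto, A. Giuliani, V. Mastropietro, Ann. Henri Poincaré 7 (2006) 809–898, §1.2 (1.2)–(1.3) (Schwinger functions at unequal
  imaginary times), §2.1 (2.8) (their perturbation series). [BenfattoGiulianiMastropietro2006]
* O. Bratteli, D. W. Robinson, *Operator Algebras and Quantum Statistical Mechanics II*, 2nd ed. (1997), §5.4.1. [BratteliRobinsonII1997]
-/

noncomputable section

open scoped Matrix.Norms.L2Operator
open Finset Finset.Nat MeasureTheory Filter Topology NormedSpace Literature.MathematicalPhysics.QuantumLattice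

namespace Matrix

variable {m : Type*} [Fintype m] [DecidableEq m]

/-- Conjugation distributes over an ordered product: `e^{Z}(∏ l)e^{-Z} = ∏ (e^{Z} l e^{-Z})` (any square matrices). [folklore] -/
private theorem exp_mul_listProd_mul_exp_neg (Z : Matrix m m ℂ) :
    ∀ l : List (Matrix m m ℂ), exp Z * l.prod * exp (-Z) = (l.map fun T => exp Z * T * exp (-Z)).prod
  | [] => by
    rw [List.prod_nil, List.map_nil, List.prod_nil, Matrix.mul_one,
      ← Matrix.exp_add_of_commute _ _ (Commute.refl Z).neg_right, add_neg_cancel, exp_zero]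
  | T :: l => by
    rw [List.prod_cons, List.map_cons, List.prod_cons, exp_mul_mul_mul_exp_neg, exp_mul_listProd_mul_exp_neg Z l]

/-- Shifting a conjugation: `e^{aZ}(e^{bZ} T e^{-bZ})e^{-aZ} = e^{(a+b)Z} T e^{-(a+b)Z}`. [folklore] -/
private theorem exp_smul_conj_conj (Z T : Matrix m m ℂ) (a b : ℝ) :
    exp (a • Z) * (exp (b • Z) * T * exp (-(b • Z))) * exp (-(a • Z)) = exp ((a + b) • Z) * T * exp (-((a + b) • Z)) := by
  have hc : Commute (a • Z) (b • Z) := ((Commute.refl Z).smul_left a).smul_right b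
  have h1 : exp (a • Z) * exp (b • Z) = exp ((a + b) • Z) := by rw [add_smul, Matrix.exp_add_of_commute _ _ hc]
  have h2 : exp (-(b • Z)) * exp (-(a • Z)) = exp (-((a + b) • Z)) := by
    rw [add_smul, neg_add, add_comm, Matrix.exp_add_of_commute _ _ (hc.symm.neg_left.neg_right)]
  calc exp (a • Z) * (exp (b • Z) * T * exp (-(b • Z))) * exp (-(a • Z))
      = (exp (a • Z) * exp (b • Z)) * T * (exp (-(b • Z)) * exp (-(a • Z))) := by noncomm_ring
    _ = exp ((a + b) • Z) * T * exp (-((a + b) • Z)) := by rw [h1, h2]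

omit [Fintype m] [DecidableEq m] in
/-- A real multiple of `-β • H₀` as a complex multiple of `H₀`: `a • (-β • H₀) = (a·(-β)) • H₀`. [folklore] -/
private theorem real_smul_neg_smul (a β : ℝ) (H₀ : Matrix m m ℂ) :
    a • (-(β : ℂ) • H₀) = (((a : ℝ) : ℂ) * -(β : ℂ)) • H₀ := by
  rw [← Complex.coe_smul, smul_smul]

/-- **The two-time Dyson integrand of a Gibbs weight with a perturbation `V = Σ_r v_r W_r`.**  With `A = -βH₀`, `B = -βV`, for all
observables `X, Y`, all `t₁, t₂` with `t₁ + t₂ = 1`, and all `u ∈ ℝ^k`, `u' ∈ ℝ^j`: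
`Tr((∏_i e^{u_iA}Be^{-u_iA}) e^{t₁A} X ((∏_l e^{u'_lA}Be^{-u'_lA}) e^{t₂A} Y))
   = (-β)^{k+j} Σ_f Σ_{f'} (∏_i v_{f i})(∏_l v_{f' l}) · Tr(e^{-βH₀} · Y · ∏_i W_{f i}(s_i) · X(s_X) · ∏_l W_{f' l}(s_X + s'_l))`,
`s_i = -βu_i`, `s_X = -βt₁`, `s'_l = -βu'_l`, `O(s) = e^{sH₀}Oe^{-sH₀}` — the free un-normalised expectation of the word with `Y` first (time `0`)
and `X` inserted at time `-βt₁` between the two vertex blocks. [cite: BenfattoGiulianiMastropietro2006, §2.1 (2.8)] -/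
theorem trace_dysonIntegrand_twoTime_gibbs {R : Type*} [Fintype R] (β : ℝ) (H₀ X Y : Matrix m m ℂ) (v : R → ℂ)
    (W : R → Matrix m m ℂ) {t₁ t₂ : ℝ} (ht : t₁ + t₂ = 1) (k j : ℕ) (u : Fin k → ℝ) (u' : Fin j → ℝ) :
    ((List.ofFn fun i : Fin k =>
          exp (u i • (-(β : ℂ) • H₀)) * (-(β : ℂ) • ∑ r, v r • W r) * exp (-(u i • (-(β : ℂ) • H₀)))).prod *
        exp (t₁ • (-(β : ℂ) • H₀)) * X *
        (((List.ofFn fun l : Fin j =>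
            exp (u' l • (-(β : ℂ) • H₀)) * (-(β : ℂ) • ∑ r, v r • W r) * exp (-(u' l • (-(β : ℂ) • H₀)))).prod *
          exp (t₂ • (-(β : ℂ) • H₀))) * Y)).trace =
      (-(β : ℂ)) ^ (k + j) * ∑ f : Fin k → R, ∑ f' : Fin j → R, ((∏ i, v (f i)) * ∏ l, v (f' l)) *
        (Matrix.gibbsWeight β H₀ * (Y *
          ((List.ofFn fun i : Fin k =>
              exp ((((u i : ℝ) : ℂ) * -(β : ℂ)) • H₀) * W (f i) * exp (-((((u i : ℝ) : ℂ) * -(β : ℂ)) • H₀))).prod *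
            (exp ((((t₁ : ℝ) : ℂ) * -(β : ℂ)) • H₀) * X * exp (-((((t₁ : ℝ) : ℂ) * -(β : ℂ)) • H₀))) *
            (List.ofFn fun l : Fin j =>
              exp (((((t₁ + u' l : ℝ) : ℂ)) * -(β : ℂ)) • H₀) * W (f' l) *
                exp (-(((((t₁ + u' l : ℝ) : ℂ)) * -(β : ℂ)) • H₀))).prod))).trace := by
  set A : Matrix m m ℂ := -(β : ℂ) • H₀ with hA
  -- the evolved perturbations as finite sums (first block at `u_i`, second block shifted by `t₁`)
  have hfac : ∀ w : ℝ, exp (w • A) * (-(β : ℂ) • ∑ r, v r • W r) * exp (-(w • A)) =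
      -(β : ℂ) • ∑ r, v r • (exp ((((w : ℝ) : ℂ) * -(β : ℂ)) • H₀) * W r * exp (-((((w : ℝ) : ℂ) * -(β : ℂ)) • H₀))) := by
    intro w
    rw [hA, real_smul_neg_smul, Matrix.mul_smul, Matrix.smul_mul, exp_mul_sum_smul_mul_exp_neg]
  -- step 1: regroup the exponentials around `X` and the second block
  have hexp1 : exp (t₁ • A) * exp (t₂ • A) = exp A := by
    rw [← Matrix.exp_add_of_commute _ _ (((Commute.refl A).smul_left t₁).smul_right t₂), ← add_smul, ht, one_smul]
  have hexp0 : exp (-(t₁ • A)) * exp (t₁ • A) = 1 := by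
    rw [← Matrix.exp_add_of_commute _ _ (Commute.refl (t₁ • A)).neg_left, neg_add_cancel, exp_zero]
  set P₁ := (List.ofFn fun i : Fin k => exp (u i • A) * (-(β : ℂ) • ∑ r, v r • W r) * exp (-(u i • A))).prod with hP₁
  set P₂ := (List.ofFn fun l : Fin j => exp (u' l • A) * (-(β : ℂ) • ∑ r, v r • W r) * exp (-(u' l • A))).prod with hP₂
  have hcancel : ∀ Z : Matrix m m ℂ, exp (-(t₁ • A)) * (exp (t₁ • A) * Z) = Z := fun Z => by
    rw [← Matrix.mul_assoc, hexp0, Matrix.one_mul]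
  have hregroup : P₁ * exp (t₁ • A) * X * ((P₂ * exp (t₂ • A)) * Y) =
      P₁ * (exp (t₁ • A) * X * exp (-(t₁ • A))) * (exp (t₁ • A) * P₂ * exp (-(t₁ • A))) * (exp A * Y) := by
    rw [← hexp1]
    simp only [Matrix.mul_assoc, hcancel]
  -- step 2: conjugating the second block shifts its times by `t₁`
  have hshift : exp (t₁ • A) * P₂ * exp (-(t₁ • A)) =
      (List.ofFn fun l : Fin j => exp ((t₁ + u' l) • A) * (-(β : ℂ) • ∑ r, v r • W r) * exp (-((t₁ + u' l) • A))).prod := by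
    rw [hP₂, exp_mul_listProd_mul_exp_neg, List.map_ofFn]
    congr 1
    refine List.ofFn_inj.2 (funext fun l => ?_)
    simp only [Function.comp_apply]
    exact exp_smul_conj_conj A _ t₁ (u' l)
  rw [hregroup, hshift]
  -- step 3: cyclicity of the trace brings `e^{A} Y` to the front
  rw [Matrix.trace_mul_comm, ← Matrix.mul_assoc]
  -- step 4: expand both blocks over the letters of the perturbation
  rw [hP₁]
  simp_rw [hfac]
  rw [prod_ofFn_smul_sum k, prod_ofFn_smul_sum j]
  have hX : exp (t₁ • A) * X * exp (-(t₁ • A)) =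
      exp ((((t₁ : ℝ) : ℂ) * -(β : ℂ)) • H₀) * X * exp (-((((t₁ : ℝ) : ℂ) * -(β : ℂ)) • H₀)) := by
    rw [hA, real_smul_neg_smul]
  rw [hX, hA, show exp (-(β : ℂ) • H₀) = Matrix.gibbsWeight β H₀ from rfl]
  simp only [Matrix.smul_mul, Matrix.mul_smul, Finset.smul_sum, smul_smul, Finset.sum_mul, Finset.mul_sum, Matrix.trace_sum,
    Matrix.trace_smul, smul_eq_mul]
  rw [Finset.sum_comm]
  refine Finset.sum_congr rfl fun f _ => Finset.sum_congr rfl fun f' _ => ?_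
  simp only [Matrix.mul_assoc, pow_add]
  ring

/-- **The two-time Dyson series of a perturbed Gibbs weight, coefficients as free expectations of time-ordered words.**  For `β > 0`,
`0 ≤ s ≤ β`, `H = H₀ + g Σ_r v_r W_r` and observables `X, Y`:
`Tr(e^{-(β-s)H} X e^{-sH} Y) = Σ_N g^N Σ_{k+j=N} ∫_{Δ_k(1-s/β)} ∫_{Δ_j(s/β)} (-β)^N Σ_{f,f'} (∏v)(∏v') ·
   Tr(e^{-βH₀} Y ∏_i W_{f i}(-βu_i) X(-(β-s)) ∏_l W_{f' l}(-(β-s)-βu'_l)) du' du`.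
[cite: BenfattoGiulianiMastropietro2006, §2.1 (2.8)] -/
theorem hasSum_dyson_trace_gibbs_twoTime_sum {R : Type*} [Fintype R] {β : ℝ} (hβ : 0 < β) (H₀ X Y : Matrix m m ℂ)
    (v : R → ℂ) (W : R → Matrix m m ℂ) (g : ℂ) {s : ℝ} (hs0 : 0 ≤ s) (hsβ : s ≤ β) :
    HasSum (fun N : ℕ => g ^ N * ∑ kj ∈ antidiagonal N,
        orderedIntegral kj.1 (fun u : Fin kj.1 → ℝ =>
          orderedIntegral kj.2 (fun u' : Fin kj.2 → ℝ =>
            (-(β : ℂ)) ^ (kj.1 + kj.2) * ∑ f : Fin kj.1 → R, ∑ f' : Fin kj.2 → R, ((∏ i, v (f i)) * ∏ l, v (f' l)) *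
              (Matrix.gibbsWeight β H₀ * (Y *
                ((List.ofFn fun i : Fin kj.1 =>
                    exp ((((u i : ℝ) : ℂ) * -(β : ℂ)) • H₀) * W (f i) * exp (-((((u i : ℝ) : ℂ) * -(β : ℂ)) • H₀))).prod *
                  (exp (((((β - s) / β : ℝ) : ℂ) * -(β : ℂ)) • H₀) * X * exp (-(((((β - s) / β : ℝ) : ℂ) * -(β : ℂ)) • H₀))) *
                  (List.ofFn fun l : Fin kj.2 =>
                    exp ((((((β - s) / β + u' l : ℝ) : ℂ)) * -(β : ℂ)) • H₀) * W (f' l) *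
                      exp (-((((((β - s) / β + u' l : ℝ) : ℂ)) * -(β : ℂ)) • H₀))).prod))).trace)
            (s / β)) ((β - s) / β))
      (exp (-((((β - s : ℝ) : ℂ)) • (H₀ + g • ∑ r, v r • W r))) * X *
        (exp (-((s : ℂ) • (H₀ + g • ∑ r, v r • W r))) * Y)).trace := by
  have ht : (β - s) / β + s / β = 1 := by rw [← add_div, sub_add_cancel, div_self hβ.ne']
  have h := hasSum_dyson_trace_gibbs_twoTime hβ H₀ (∑ r, v r • W r) X Y g hs0 hsβ
  refine h.congr_fun fun N => ?_
  refine congrArg (fun S => g ^ N * S) (Finset.sum_congr rfl fun kj _ => ?_)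
  rw [trace_dysonTerm_mul_dysonTerm_mul_eq_orderedIntegral]
  refine congrArg (fun F => orderedIntegral kj.1 F ((β - s) / β)) (funext fun u => ?_)
  refine congrArg (fun F => orderedIntegral kj.2 F (s / β)) (funext fun u' => ?_)
  exact (trace_dysonIntegrand_twoTime_gibbs β H₀ X Y v W ht kj.1 kj.2 u u').symm

end Matrix

end
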